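import Summits.HodgeConjecture.HodgeConjecture.Theorems.Ring2WeilCoverageCMFieldNormParity
import Summits.HodgeConjecture.HodgeConjecture.Theorems.Ring2WeilCoverageCMFieldInertPrimes
import HarnessLib

/-!
# Weil-type components over quartic CM fields with NO RATIONAL DISCRIMINANT, II: the certificate
# `[u + vσ] ≠ [c]` for EVERY `c ∈ ℚ^×` on Deligne's carriers, and the rows of `ℚ(ζ₅)` and `ℚ(√-(2+√2))`

research route conditional on HC_CM; not a corollary; Q11.4-sentence-2 already refuted in dim ≥ 3.
Cell `pub-hodge-ring2`, seat `ring2-b03` (gen 57); kernel certificates for the Weil-type family-coverage census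
`HOME/WEIL-FAMILY-COVERAGE.md` §b03.5 (operator priority5 2026-08-22T11:46:08Z). Companion of
`Ring2WeilCoverageCMFieldNormParity.lean` (the ENGINE `normParity_sq`: on Deligne's carriers `F = ℚ[S]/(R)`,
`E = ℚ[T]/(R(T²))`, `R = S² + pS + q`, the integer form `G = N_{E/ℚ}` never takes a value `ℓ^{odd}·unit·square`
when every place of `F` over `ℓ` is inert in `E/F`).

* §1 **`mk_ne_mk_ratCast_of_normParity`**: for `δ = u + vσ ∈ ℤ[σ]` with `N_{F/ℚ}(δ) = u² - puv + qv² = ℓ^{2e+1}·w`,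
  `ℓ ∤ w` (at such a prime `ℓ`: roots `t₁, t₂` of `R` mod `ℓ` non-squares, `ℓ² ∤ R(tᵢ)`): the class
  `[δ] ∈ F^×/Nm_{E/F}(E^×) = cmNormResidueGroup R` differs from `[c]` for EVERY `c ∈ ℚ^×` (`[δ] = [c]` gives
  `δ = c·z z̄ = c·(x² - σy²)` by `Deligne1982.exists_eq_ratCast_mul_norm_of_mk_eq`; in coordinates `u = cX`,
  `v = cY`; clearing denominators `c.num²·G = ℓ^{2e+1}·w·(c.den·m²)²`, against the engine). COROLLARIES:
  `[δ] ≠ [(-1)²] = [1]` — the component `W8.E.[δ]` is NON-SPLIT, no `E`-Lagrangian member (Deligne Cor. 4.2;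
  `mk_ne_splitDiscriminantClassCM_of_normParity`) — and `[δ] ≠ [n]` for every integer `n ≠ 0`
  (`mk_ne_mk_intCast_of_normParity`): the row `W8.E.[δ]` is NONE of the integer-indexed rows `[n]` decided by
  gens 46–53 — the integer tables enumerate a PROPER subset of the components.
* §2 INSTANCES, `(field, ℓ)`-level (`δ` with `N_{F/ℚ} δ = ℓ·w`, `ℓ ∤ w`, arbitrary) and row-level (the least
  representatives of §b03.5 with «least rational n: –», written on `{1, σ}` by the table's own convention
  `σ = η²`): `ℚ(ζ₅)` (`R = S² + 5S + 5`, `σ = −(5+√5)/2`; `ℓ = 19, 29`) and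
  `ℚ(√-(2+√2))` (`R = S² + 4S + 2`, `σ = −(2+√2)`; `ℓ = 31, 41`). The four biquadratic fields are in
  `…IrrationalRowsBiquadratic.lean` (`ℚ(ζ₈)`, `ℚ(ζ₁₂)`) and `…IrrationalRowsBiquadraticSqrtFive.lean`
  (`ℚ(√-3,√5)`, `ℚ(i,√5)`), the non-Galois field `ℚ(√-(3+√2))` in `…IrrationalRowsNonGalois.lean`; each
  `…_irrational_rows` theorem lists ALL rows inside `S6` of §b03.5 with a tabulated representative and «–»
  (`|T| = 2` and `|T| = 4`): 16 for `ℚ(ζ₅)`, 11 for `ℚ(√-(2+√2))`.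

No named fact, no definition, no `sorry`; nothing about the Hodge conjecture is asserted.
References: [Deligne1982HodgeCycles] §4 p. 30 (1), Cor. 4.2, Lemma 4.6; [Landherr1936HermitianForms]. -/

noncomputable section

set_option linter.dupNamespace false

open Polynomial

namespace Summit.HodgeConjecture.HodgeConjecture.Ring2.WeilCoverageCM

open Literature.AlgebraicGeometry.Deligne1982
open Literature.AlgebraicGeometry.HodgeTheory (splitDiscriminantClassCM)

/-! ### §1 The certificate on Deligne's carriers: `[u + vσ] ≠ [c]` for every `c ∈ ℚ^×` -/

/-- **No rational representative / not the split class — the norm-parity certificate.** For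
`R = S² + pS + q` with both carrier polynomials irreducible (instance arguments), a prime `ℓ` with roots
`t₁, t₂` of `R` mod `ℓ` (`t₁ + t₂ ≡ -p`, `t₁t₂ ≡ q`) that are both non-squares mod `ℓ` and `ℓ² ∤ R(tᵢ)` (every
place of `F` over `ℓ` inert in `E/F`), and `δ = u + vσ ∈ ℤ[σ]` whose norm `N_{F/ℚ}(δ) = u² - puv + qv²` is
`ℓ^{2e+1}·w` with `ℓ ∤ w`: the class `[δ] ∈ F^×/Nm_{E/F}(E^×)` is different from `[c]` for EVERY `c ∈ ℚ^×`. So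
the Weil-type component `(E, d = 4, [δ])` is none of the integer-indexed rows `[n]` of the census tables and
(`c = 1`) is not the split row. PROOF: `[δ] = [c]` gives `δ = c·z z̄ = c·(x² - σy²)` (Deligne p. 30,
`exists_eq_ratCast_mul_norm_of_mk_eq`); in coordinates `u = cX`, `v = cY`; clearing denominators,
`c.num²·G = ℓ^{2e+1}·w·(c.den·m²)²`, against `normParity_sq`. [cite: Deligne1982HodgeCycles, §4 p. 30 (1) and Cor. 4.2]
[cite: Landherr1936HermitianForms] -/
theorem mk_ne_mk_ratCast_of_normParity {p q : ℤ} {R : Polynomial ℤ}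
    (hR : R = X ^ 2 + C p * X + C q) [Fact (Irreducible (realPolyQ R))] [Fact (Irreducible (cmPolyQ R))]
    (ℓ : ℕ) (hℓ : ℓ.Prime) (t₁ t₂ : ℤ) (hsum : (ℓ : ℤ) ∣ t₁ + t₂ + p) (hprod : (ℓ : ℤ) ∣ t₁ * t₂ - q)
    (hq₁ : ∀ r : ZMod ℓ, r ^ 2 ≠ (t₁ : ZMod ℓ)) (hq₂ : ∀ r : ZMod ℓ, r ^ 2 ≠ (t₂ : ZMod ℓ))
    (hR₁ : ¬ (ℓ : ℤ) ^ 2 ∣ t₁ ^ 2 + p * t₁ + q) (hR₂ : ¬ (ℓ : ℤ) ^ 2 ∣ t₂ ^ 2 + p * t₂ + q)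
    (u v : ℤ) (e : ℕ) (w : ℤ) (hw : ¬ (ℓ : ℤ) ∣ w) (hN : u ^ 2 - p * u * v + q * v ^ 2 = (ℓ : ℤ) ^ (2 * e + 1) * w)
    (δ : (realField R)ˣ)
    (hδ : (δ : realField R) = AdjoinRoot.of (realPolyQ R) u + AdjoinRoot.of (realPolyQ R) v * AdjoinRoot.root (realPolyQ R))
    (c : ℚ) (γ : (realField R)ˣ) (hγ : (γ : realField R) = (c : realField R)) :
    (QuotientGroup.mk δ : cmNormResidueGroup R) ≠ QuotientGroup.mk γ := by
  haveI : Fact ℓ.Prime := ⟨hℓ⟩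
  intro h
  -- `δ = c · z z̄`, `z = a + bη`, `z z̄ = a² - σ b²`
  obtain ⟨z, -, hz⟩ := exists_eq_ratCast_mul_norm_of_mk_eq (q := δ) (u := γ) (c := c) hγ h
  obtain ⟨a, b, rfl⟩ := exists_eq_realToCM_add_mul_cmRoot R z
  rw [norm_coords, algebraMap_realField_eq, hδ] at hz
  have hcE : (c : cmField R) = realToCM R (c : realField R) := (map_ratCast (realToCM R) c).symm
  rw [hcE, ← map_mul] at hz
  have hF := (realToCM R).injective hz
  obtain ⟨a₀, a₁, rfl⟩ := exists_coords_quadratic hR a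
  obtain ⟨b₀, b₁, rfl⟩ := exists_coords_quadratic hR b
  rw [normForm_coords hR] at hF
  have hcF : (c : realField R) = AdjoinRoot.of (realPolyQ R) c := (map_ratCast _ c).symm
  rw [hcF] at hF
  -- coordinates: `u = c X`, `v = c Y`
  have key : AdjoinRoot.of (realPolyQ R)
        ((u : ℚ) - c * (a₀ ^ 2 - q * a₁ ^ 2 + 2 * q * b₀ * b₁ - p * q * b₁ ^ 2)) +
      AdjoinRoot.of (realPolyQ R)
        ((v : ℚ) - c * (2 * a₀ * a₁ - p * a₁ ^ 2 - b₀ ^ 2 + 2 * p * b₀ * b₁ - (p ^ 2 - q) * b₁ ^ 2)) *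
        AdjoinRoot.root (realPolyQ R) = 0 := by
    have e1 : AdjoinRoot.of (realPolyQ R)
          ((u : ℚ) - c * (a₀ ^ 2 - q * a₁ ^ 2 + 2 * q * b₀ * b₁ - p * q * b₁ ^ 2))
        = AdjoinRoot.of (realPolyQ R) (u : ℚ)
          - AdjoinRoot.of (realPolyQ R) c
            * AdjoinRoot.of (realPolyQ R) (a₀ ^ 2 - q * a₁ ^ 2 + 2 * q * b₀ * b₁ - p * q * b₁ ^ 2) := by
      rw [map_sub, map_mul]
    have e2 : AdjoinRoot.of (realPolyQ R)
          ((v : ℚ) - c * (2 * a₀ * a₁ - p * a₁ ^ 2 - b₀ ^ 2 + 2 * p * b₀ * b₁ - (p ^ 2 - q) * b₁ ^ 2))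
        = AdjoinRoot.of (realPolyQ R) (v : ℚ)
          - AdjoinRoot.of (realPolyQ R) c
            * AdjoinRoot.of (realPolyQ R) (2 * a₀ * a₁ - p * a₁ ^ 2 - b₀ ^ 2 + 2 * p * b₀ * b₁ - (p ^ 2 - q) * b₁ ^ 2) := by
      rw [map_sub, map_mul]
    rw [e1, e2]
    linear_combination hF
  obtain ⟨hX, hY⟩ := coords_eq_zero_quadratic hR key
  -- clear denominators
  set m : ℕ := a₀.den * a₁.den * b₀.den * b₁.den with hm
  have hm0 : (m : ℤ) ≠ 0 := by
    have : 0 < m := by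
      rw [hm]; exact Nat.mul_pos (Nat.mul_pos (Nat.mul_pos a₀.den_pos a₁.den_pos) b₀.den_pos) b₁.den_pos
    exact_mod_cast this.ne'
  have keyd : ∀ (r : ℚ) (k : ℕ), ((r.num * k : ℤ) : ℚ) = r * (r.den * k : ℕ) := by
    intro r k
    push_cast
    rw [← mul_assoc, Rat.mul_den_eq_num]
  obtain ⟨A, hA⟩ : ∃ A : ℤ, (A : ℚ) = a₀ * m :=
    ⟨a₀.num * (a₁.den * b₀.den * b₁.den : ℕ), by rw [keyd, hm]; push_cast; ring⟩
  obtain ⟨B, hB⟩ : ∃ B : ℤ, (B : ℚ) = a₁ * m :=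
    ⟨a₁.num * (a₀.den * b₀.den * b₁.den : ℕ), by rw [keyd, hm]; push_cast; ring⟩
  obtain ⟨Cc, hC⟩ : ∃ Cc : ℤ, (Cc : ℚ) = b₀ * m :=
    ⟨b₀.num * (a₀.den * a₁.den * b₁.den : ℕ), by rw [keyd, hm]; push_cast; ring⟩
  obtain ⟨D, hD⟩ : ∃ D : ℤ, (D : ℚ) = b₁ * m :=
    ⟨b₁.num * (a₀.den * a₁.den * b₀.den : ℕ), by rw [keyd, hm]; push_cast; ring⟩
  have hc0 : c ≠ 0 := by
    rintro rfl
    rw [Rat.cast_zero] at hγ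
    exact γ.ne_zero hγ
  have hnum : c.num ≠ 0 := Rat.num_ne_zero.2 hc0
  have hcnd : (c.num : ℚ) = c * c.den := by rw [Rat.mul_den_eq_num]
  -- integer equations `c.num · X(A,B,C,D) = u · c.den · m²`, same for `Y`
  have hXZ : c.num * (A ^ 2 - q * B ^ 2 + 2 * q * Cc * D - p * q * D ^ 2) = u * (c.den * (m : ℤ) ^ 2) := by
    have h1 : (c.num : ℚ) * ((A : ℚ) ^ 2 - q * (B : ℚ) ^ 2 + 2 * q * (Cc : ℚ) * D - p * q * (D : ℚ) ^ 2)
        = (u : ℚ) * ((c.den : ℚ) * ((m : ℤ) : ℚ) ^ 2) := by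
      rw [hA, hB, hC, hD, hcnd]
      have hu : (u : ℚ) = c * (a₀ ^ 2 - q * a₁ ^ 2 + 2 * q * b₀ * b₁ - p * q * b₁ ^ 2) := by linarith
      rw [hu]; push_cast; ring
    exact_mod_cast h1
  have hYZ : c.num * (2 * A * B - p * B ^ 2 - Cc ^ 2 + 2 * p * Cc * D - (p ^ 2 - q) * D ^ 2)
      = v * (c.den * (m : ℤ) ^ 2) := by
    have h1 : (c.num : ℚ) * (2 * (A : ℚ) * B - p * (B : ℚ) ^ 2 - (Cc : ℚ) ^ 2 + 2 * p * (Cc : ℚ) * D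
          - (p ^ 2 - q) * (D : ℚ) ^ 2)
        = (v : ℚ) * ((c.den : ℚ) * ((m : ℤ) : ℚ) ^ 2) := by
      rw [hA, hB, hC, hD, hcnd]
      have hv : (v : ℚ) = c * (2 * a₀ * a₁ - p * a₁ ^ 2 - b₀ ^ 2 + 2 * p * b₀ * b₁ - (p ^ 2 - q) * b₁ ^ 2) := by
        linarith
      rw [hv]; push_cast; ring
    exact_mod_cast h1
  -- `c.num² · G = ℓ^{2e+1} · w · (c.den · m²)²`
  have hM : (c.den : ℤ) * (m : ℤ) ^ 2 ≠ 0 := mul_ne_zero (by exact_mod_cast c.den_pos.ne') (pow_ne_zero 2 hm0)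
  refine normParity_sq p q ℓ t₁ t₂ hsum hprod hq₁ hq₂ hR₁ hR₂ _ e c.num ((c.den : ℤ) * (m : ℤ) ^ 2) A B Cc D w
    le_rfl hnum hM hw ?_
  have eG : c.num ^ 2 * ((A ^ 2 - q * B ^ 2 + 2 * q * Cc * D - p * q * D ^ 2) ^ 2
        - p * (A ^ 2 - q * B ^ 2 + 2 * q * Cc * D - p * q * D ^ 2)
            * (2 * A * B - p * B ^ 2 - Cc ^ 2 + 2 * p * Cc * D - (p ^ 2 - q) * D ^ 2)
        + q * (2 * A * B - p * B ^ 2 - Cc ^ 2 + 2 * p * Cc * D - (p ^ 2 - q) * D ^ 2) ^ 2)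
      = (c.num * (A ^ 2 - q * B ^ 2 + 2 * q * Cc * D - p * q * D ^ 2)) ^ 2
        - p * (c.num * (A ^ 2 - q * B ^ 2 + 2 * q * Cc * D - p * q * D ^ 2))
            * (c.num * (2 * A * B - p * B ^ 2 - Cc ^ 2 + 2 * p * Cc * D - (p ^ 2 - q) * D ^ 2))
        + q * (c.num * (2 * A * B - p * B ^ 2 - Cc ^ 2 + 2 * p * Cc * D - (p ^ 2 - q) * D ^ 2)) ^ 2 := by
    ring
  rw [eG, hXZ, hYZ]
  linear_combination ((c.den : ℤ) * (m : ℤ) ^ 2) ^ 2 * hN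

/-- **Corollary: `[u + vσ] ≠ [(-1)²] = [1]`** — the component `W8.E.[u + vσ]` is NON-SPLIT (no `E`-Lagrangian
member, Deligne Cor. 4.2) — under the norm-parity hypotheses. [cite: Deligne1982HodgeCycles, §4 p. 30 (1) and Cor. 4.2] -/
theorem mk_ne_splitDiscriminantClassCM_of_normParity {p q : ℤ} {R : Polynomial ℤ}
    (hR : R = X ^ 2 + C p * X + C q) [Fact (Irreducible (realPolyQ R))] [Fact (Irreducible (cmPolyQ R))]
    (ℓ : ℕ) (hℓ : ℓ.Prime) (t₁ t₂ : ℤ) (hsum : (ℓ : ℤ) ∣ t₁ + t₂ + p) (hprod : (ℓ : ℤ) ∣ t₁ * t₂ - q)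
    (hq₁ : ∀ r : ZMod ℓ, r ^ 2 ≠ (t₁ : ZMod ℓ)) (hq₂ : ∀ r : ZMod ℓ, r ^ 2 ≠ (t₂ : ZMod ℓ))
    (hR₁ : ¬ (ℓ : ℤ) ^ 2 ∣ t₁ ^ 2 + p * t₁ + q) (hR₂ : ¬ (ℓ : ℤ) ^ 2 ∣ t₂ ^ 2 + p * t₂ + q)
    (u v : ℤ) (e : ℕ) (w : ℤ) (hw : ¬ (ℓ : ℤ) ∣ w) (hN : u ^ 2 - p * u * v + q * v ^ 2 = (ℓ : ℤ) ^ (2 * e + 1) * w)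
    (δ : (realField R)ˣ)
    (hδ : (δ : realField R) = AdjoinRoot.of (realPolyQ R) u + AdjoinRoot.of (realPolyQ R) v * AdjoinRoot.root (realPolyQ R)) :
    (QuotientGroup.mk δ : cmNormResidueGroup R) ≠ splitDiscriminantClassCM R 2 := by
  rw [splitDiscriminantClassCM, neg_one_sq]
  exact mk_ne_mk_ratCast_of_normParity hR ℓ hℓ t₁ t₂ hsum hprod hq₁ hq₂ hR₁ hR₂ u v e w hw hN δ hδ 1 1
    (by rw [Units.val_one, Rat.cast_one])

/-- **Corollary: no rational representative, integer form** — `[u + vσ] ≠ [n]` for every non-zero integer `n`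
(so the row `W8.E.[u + vσ]` is none of the rows `[n]` of the integer tables). [cite: Deligne1982HodgeCycles, §4 p. 30 (1)] -/
theorem mk_ne_mk_intCast_of_normParity {p q : ℤ} {R : Polynomial ℤ}
    (hR : R = X ^ 2 + C p * X + C q) [Fact (Irreducible (realPolyQ R))] [Fact (Irreducible (cmPolyQ R))]
    (ℓ : ℕ) (hℓ : ℓ.Prime) (t₁ t₂ : ℤ) (hsum : (ℓ : ℤ) ∣ t₁ + t₂ + p) (hprod : (ℓ : ℤ) ∣ t₁ * t₂ - q)
    (hq₁ : ∀ r : ZMod ℓ, r ^ 2 ≠ (t₁ : ZMod ℓ)) (hq₂ : ∀ r : ZMod ℓ, r ^ 2 ≠ (t₂ : ZMod ℓ))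
    (hR₁ : ¬ (ℓ : ℤ) ^ 2 ∣ t₁ ^ 2 + p * t₁ + q) (hR₂ : ¬ (ℓ : ℤ) ^ 2 ∣ t₂ ^ 2 + p * t₂ + q)
    (u v : ℤ) (e : ℕ) (w : ℤ) (hw : ¬ (ℓ : ℤ) ∣ w) (hN : u ^ 2 - p * u * v + q * v ^ 2 = (ℓ : ℤ) ^ (2 * e + 1) * w)
    (δ : (realField R)ˣ)
    (hδ : (δ : realField R) = AdjoinRoot.of (realPolyQ R) u + AdjoinRoot.of (realPolyQ R) v * AdjoinRoot.root (realPolyQ R))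
    (n : ℤ) (γ : (realField R)ˣ) (hγ : (γ : realField R) = AdjoinRoot.of (realPolyQ R) n) :
    (QuotientGroup.mk δ : cmNormResidueGroup R) ≠ QuotientGroup.mk γ :=
  mk_ne_mk_ratCast_of_normParity hR ℓ hℓ t₁ t₂ hsum hprod hq₁ hq₂ hR₁ hR₂ u v e w hw hN δ hδ n γ
    (by rw [hγ, ← map_ratCast (AdjoinRoot.of (realPolyQ R)), Rat.cast_intCast])

/-! ### §2 Instances -/

/-! ### `E = ℚ(ζ₅)`: `R = S² + 5S + 5` -/

/-- **ℚ(ζ₅), `ℓ = 19`** (two roots `σ ≡ 2, 12 (mod 19)`, non-squares: every place of `F` over `19` is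
inert in `E/F`): every `δ = u + vσ ∈ ℤ[σ]` with `N_{F/ℚ}(δ) = u² - 5uv + 5v² = 19·w`, `19 ∤ w`, has
`[δ] ≠ [c]` in `F^×/Nm_{E/F}(E^×)` for EVERY `c ∈ ℚ^×`. [cite: Deligne1982HodgeCycles, §4 p. 30 (1) and Cor. 4.2] -/
theorem zeta5_mk_ne_mk_ratCast_of_norm_nineteen {R : Polynomial ℤ} (hR : R = X ^ 2 + C 5 * X + C 5)
    [Fact (Irreducible (realPolyQ R))] (u v w : ℤ) (hw : ¬ (19 : ℤ) ∣ w)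
    (hN : u ^ 2 - 5 * u * v + 5 * v ^ 2 = 19 * w) (δ : (realField R)ˣ)
    (hδ : (δ : realField R) = AdjoinRoot.of (realPolyQ R) u + AdjoinRoot.of (realPolyQ R) v * AdjoinRoot.root (realPolyQ R))
    (c : ℚ) (γ : (realField R)ˣ) (hγ : (γ : realField R) = (c : realField R)) :
    (QuotientGroup.mk δ : cmNormResidueGroup R) ≠ QuotientGroup.mk γ := by
  haveI : Fact (Irreducible (cmPolyQ R)) := fact_irreducible_cmPolyQ_of_pos hR (by norm_num) (by norm_num) disc_not_sq_five_five
  exact mk_ne_mk_ratCast_of_normParity hR 19 (by norm_num) 2 12 (by norm_num) (by norm_num) (by decide) (by decide)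
    (by norm_num) (by norm_num) u v 0 w (by exact_mod_cast hw) (by rw [hN]; push_cast; ring) δ hδ c γ hγ

/-- **ℚ(ζ₅), `ℓ = 29`** (two roots `σ ≡ 3, 21 (mod 29)`, non-squares: every place of `F` over `29` is
inert in `E/F`): every `δ = u + vσ ∈ ℤ[σ]` with `N_{F/ℚ}(δ) = u² - 5uv + 5v² = 29·w`, `29 ∤ w`, has
`[δ] ≠ [c]` in `F^×/Nm_{E/F}(E^×)` for EVERY `c ∈ ℚ^×`. [cite: Deligne1982HodgeCycles, §4 p. 30 (1) and Cor. 4.2] -/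
theorem zeta5_mk_ne_mk_ratCast_of_norm_twentyNine {R : Polynomial ℤ} (hR : R = X ^ 2 + C 5 * X + C 5)
    [Fact (Irreducible (realPolyQ R))] (u v w : ℤ) (hw : ¬ (29 : ℤ) ∣ w)
    (hN : u ^ 2 - 5 * u * v + 5 * v ^ 2 = 29 * w) (δ : (realField R)ˣ)
    (hδ : (δ : realField R) = AdjoinRoot.of (realPolyQ R) u + AdjoinRoot.of (realPolyQ R) v * AdjoinRoot.root (realPolyQ R))
    (c : ℚ) (γ : (realField R)ˣ) (hγ : (γ : realField R) = (c : realField R)) :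
    (QuotientGroup.mk δ : cmNormResidueGroup R) ≠ QuotientGroup.mk γ := by
  haveI : Fact (Irreducible (cmPolyQ R)) := fact_irreducible_cmPolyQ_of_pos hR (by norm_num) (by norm_num) disc_not_sq_five_five
  exact mk_ne_mk_ratCast_of_normParity hR 29 (by norm_num) 3 21 (by norm_num) (by norm_num) (by decide) (by decide)
    (by norm_num) (by norm_num) u v 0 w (by exact_mod_cast hw) (by rw [hN]; push_cast; ring) δ hδ c γ hγ

/-- **ℚ(ζ₅): rows of §b03.5 with NO RATIONAL REPRESENTATIVE, in the kernel** — for `R = X ^ 2 + C 5 * X + C 5` LITERALLY and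
each listed `(u, v)` (convention `√5 = −(2σ + 5), i.e. σ = −(5+√5)/2`; `(u,v)` = least representative `δ` of the row `T` of §b03.5 on `{1, σ}`
— times the square shown, if `δ ∉ ℤ[σ]` —, with its norm `N_{F/ℚ}`:
  `(4,-2)` = 9+√5 {1,4}, N 76;
  `(14,2)` = 9−√5 {1,5}, N 76;
  `(16,2)` = 11−√5 {1,6}, N 116;
  `(2,-1)` = 9/2+1/2√5 {2,4}, N 19;
  `(7,1)` = 9/2−1/2√5 {2,5}, N 19;
  `(8,1)` = 11/2−1/2√5 {2,6}, N 29;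
  `(6,-3)` = 27/2+3/2√5 {3,4}, N 171;
  `(21,3)` = 27/2−3/2√5 {3,5}, N 171;
  `(24,3)` = 33/2−3/2√5 {3,6}, N 261;
  `(21,-1)` = 47/2+1/2√5 {4,6}, N 551;
  `(51,10)` = 26−5√5 {5,6}, N 551;
  `(12,-6)` = 27+3√5 {1,2,3,4}, N 684;
  `(42,6)` = 27−3√5 {1,2,3,5}, N 684;
  `(48,6)` = 33−3√5 {1,2,3,6}, N 1044;
  `(42,-2)` = 47+√5 {1,2,4,6}, N 2204;
  `(102,20)` = 52−10√5 {1,2,5,6}, N 2204):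
the class `[u + vσ]` differs from `[c]` for EVERY `c ∈ ℚ^×` — the component `W8.E.[u + vσ]` is none of the
integer-indexed rows `[n]` and not the split row. [cite: Deligne1982HodgeCycles, §4 p. 30 (1) and Cor. 4.2] -/
theorem zeta5_irrational_rows :
    haveI := fact_irreducible_realPolyQ_of_not_sq (R := X ^ 2 + C 5 * X + C 5) rfl disc_not_sq_five_five
    ∀ uv ∈ [((4 : ℤ), (-2 : ℤ)), (14, 2), (16, 2), (2, -1), (7, 1), (8, 1), (6, -3), (21, 3), (24, 3), (21, -1), (51, 10), (12, -6), (42, 6), (48, 6), (42, -2), (102, 20)],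
      ∀ δ : (realField (X ^ 2 + C 5 * X + C 5))ˣ,
        (δ : realField (X ^ 2 + C 5 * X + C 5)) = AdjoinRoot.of (realPolyQ (X ^ 2 + C 5 * X + C 5)) (uv.1 : ℚ)
            + AdjoinRoot.of (realPolyQ (X ^ 2 + C 5 * X + C 5)) (uv.2 : ℚ) * AdjoinRoot.root (realPolyQ (X ^ 2 + C 5 * X + C 5)) →
        ∀ (c : ℚ) (γ : (realField (X ^ 2 + C 5 * X + C 5))ˣ), (γ : realField (X ^ 2 + C 5 * X + C 5)) = (c : realField (X ^ 2 + C 5 * X + C 5)) →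
          (QuotientGroup.mk δ : cmNormResidueGroup (X ^ 2 + C 5 * X + C 5)) ≠ QuotientGroup.mk γ := by
  haveI := fact_irreducible_realPolyQ_of_not_sq (R := X ^ 2 + C 5 * X + C 5) rfl disc_not_sq_five_five
  intro uv huv δ hδ c γ hγ
  obtain ⟨u, v⟩ := uv
  simp only [List.mem_cons, Prod.mk.injEq, List.not_mem_nil, or_false] at huv
  rcases huv with ⟨rfl, rfl⟩ | ⟨rfl, rfl⟩ | ⟨rfl, rfl⟩ | ⟨rfl, rfl⟩ | ⟨rfl, rfl⟩ | ⟨rfl, rfl⟩ | ⟨rfl, rfl⟩ | ⟨rfl, rfl⟩ | ⟨rfl, rfl⟩ | ⟨rfl, rfl⟩ | ⟨rfl, rfl⟩ | ⟨rfl, rfl⟩ | ⟨rfl, rfl⟩ | ⟨rfl, rfl⟩ | ⟨rfl, rfl⟩ | ⟨rfl, rfl⟩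
  · exact zeta5_mk_ne_mk_ratCast_of_norm_nineteen rfl 4 (-2) (4) (by norm_num) (by norm_num) δ hδ c γ hγ
  · exact zeta5_mk_ne_mk_ratCast_of_norm_nineteen rfl 14 (2) (4) (by norm_num) (by norm_num) δ hδ c γ hγ
  · exact zeta5_mk_ne_mk_ratCast_of_norm_twentyNine rfl 16 (2) (4) (by norm_num) (by norm_num) δ hδ c γ hγ
  · exact zeta5_mk_ne_mk_ratCast_of_norm_nineteen rfl 2 (-1) (1) (by norm_num) (by norm_num) δ hδ c γ hγ
  · exact zeta5_mk_ne_mk_ratCast_of_norm_nineteen rfl 7 (1) (1) (by norm_num) (by norm_num) δ hδ c γ hγ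
  · exact zeta5_mk_ne_mk_ratCast_of_norm_twentyNine rfl 8 (1) (1) (by norm_num) (by norm_num) δ hδ c γ hγ
  · exact zeta5_mk_ne_mk_ratCast_of_norm_nineteen rfl 6 (-3) (9) (by norm_num) (by norm_num) δ hδ c γ hγ
  · exact zeta5_mk_ne_mk_ratCast_of_norm_nineteen rfl 21 (3) (9) (by norm_num) (by norm_num) δ hδ c γ hγ
  · exact zeta5_mk_ne_mk_ratCast_of_norm_twentyNine rfl 24 (3) (9) (by norm_num) (by norm_num) δ hδ c γ hγ
  · exact zeta5_mk_ne_mk_ratCast_of_norm_nineteen rfl 21 (-1) (29) (by norm_num) (by norm_num) δ hδ c γ hγ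
  · exact zeta5_mk_ne_mk_ratCast_of_norm_nineteen rfl 51 (10) (29) (by norm_num) (by norm_num) δ hδ c γ hγ
  · exact zeta5_mk_ne_mk_ratCast_of_norm_nineteen rfl 12 (-6) (36) (by norm_num) (by norm_num) δ hδ c γ hγ
  · exact zeta5_mk_ne_mk_ratCast_of_norm_nineteen rfl 42 (6) (36) (by norm_num) (by norm_num) δ hδ c γ hγ
  · exact zeta5_mk_ne_mk_ratCast_of_norm_twentyNine rfl 48 (6) (36) (by norm_num) (by norm_num) δ hδ c γ hγ
  · exact zeta5_mk_ne_mk_ratCast_of_norm_nineteen rfl 42 (-2) (116) (by norm_num) (by norm_num) δ hδ c γ hγ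
  · exact zeta5_mk_ne_mk_ratCast_of_norm_nineteen rfl 102 (20) (116) (by norm_num) (by norm_num) δ hδ c γ hγ

/-! ### `E = ℚ(√-(2+√2))`: `R = S² + 4S + 2` -/

/-- **ℚ(√-(2+√2)), `ℓ = 31`** (two roots `σ ≡ 6, 21 (mod 31)`, non-squares: every place of `F` over `31` is
inert in `E/F`): every `δ = u + vσ ∈ ℤ[σ]` with `N_{F/ℚ}(δ) = u² - 4uv + 2v² = 31·w`, `31 ∤ w`, has
`[δ] ≠ [c]` in `F^×/Nm_{E/F}(E^×)` for EVERY `c ∈ ℚ^×`. [cite: Deligne1982HodgeCycles, §4 p. 30 (1) and Cor. 4.2] -/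
theorem sqrtNegTwoPlusSqrtTwo_mk_ne_mk_ratCast_of_norm_thirtyOne {R : Polynomial ℤ} (hR : R = X ^ 2 + C 4 * X + C 2)
    [Fact (Irreducible (realPolyQ R))] (u v w : ℤ) (hw : ¬ (31 : ℤ) ∣ w)
    (hN : u ^ 2 - 4 * u * v + 2 * v ^ 2 = 31 * w) (δ : (realField R)ˣ)
    (hδ : (δ : realField R) = AdjoinRoot.of (realPolyQ R) u + AdjoinRoot.of (realPolyQ R) v * AdjoinRoot.root (realPolyQ R))
    (c : ℚ) (γ : (realField R)ˣ) (hγ : (γ : realField R) = (c : realField R)) :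
    (QuotientGroup.mk δ : cmNormResidueGroup R) ≠ QuotientGroup.mk γ := by
  haveI : Fact (Irreducible (cmPolyQ R)) := fact_irreducible_cmPolyQ_of_pos hR (by norm_num) (by norm_num) disc_not_sq_four_two
  exact mk_ne_mk_ratCast_of_normParity hR 31 (by norm_num) 6 21 (by norm_num) (by norm_num) (by decide) (by decide)
    (by norm_num) (by norm_num) u v 0 w (by exact_mod_cast hw) (by rw [hN]; push_cast; ring) δ hδ c γ hγ

/-- **ℚ(√-(2+√2)), `ℓ = 41`** (two roots `σ ≡ 15, 22 (mod 41)`, non-squares: every place of `F` over `41` is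
inert in `E/F`): every `δ = u + vσ ∈ ℤ[σ]` with `N_{F/ℚ}(δ) = u² - 4uv + 2v² = 41·w`, `41 ∤ w`, has
`[δ] ≠ [c]` in `F^×/Nm_{E/F}(E^×)` for EVERY `c ∈ ℚ^×`. [cite: Deligne1982HodgeCycles, §4 p. 30 (1) and Cor. 4.2] -/
theorem sqrtNegTwoPlusSqrtTwo_mk_ne_mk_ratCast_of_norm_fortyOne {R : Polynomial ℤ} (hR : R = X ^ 2 + C 4 * X + C 2)
    [Fact (Irreducible (realPolyQ R))] (u v w : ℤ) (hw : ¬ (41 : ℤ) ∣ w)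
    (hN : u ^ 2 - 4 * u * v + 2 * v ^ 2 = 41 * w) (δ : (realField R)ˣ)
    (hδ : (δ : realField R) = AdjoinRoot.of (realPolyQ R) u + AdjoinRoot.of (realPolyQ R) v * AdjoinRoot.root (realPolyQ R))
    (c : ℚ) (γ : (realField R)ˣ) (hγ : (γ : realField R) = (c : realField R)) :
    (QuotientGroup.mk δ : cmNormResidueGroup R) ≠ QuotientGroup.mk γ := by
  haveI : Fact (Irreducible (cmPolyQ R)) := fact_irreducible_cmPolyQ_of_pos hR (by norm_num) (by norm_num) disc_not_sq_four_two
  exact mk_ne_mk_ratCast_of_normParity hR 41 (by norm_num) 15 22 (by norm_num) (by norm_num) (by decide) (by decide)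
    (by norm_num) (by norm_num) u v 0 w (by exact_mod_cast hw) (by rw [hN]; push_cast; ring) δ hδ c γ hγ

/-- **ℚ(√-(2+√2)): rows of §b03.5 with NO RATIONAL REPRESENTATIVE, in the kernel** — for `R = X ^ 2 + C 4 * X + C 2` LITERALLY and
each listed `(u, v)` (convention `√2 = −(σ + 2), i.e. σ = −(2+√2)`; `(u,v)` = least representative `δ` of the row `T` of §b03.5 on `{1, σ}`
— times the square shown, if `δ ∉ ℤ[σ]` —, with its norm `N_{F/ℚ}`:
  `(1,-3)` = 7+3√2 {1,4}, N 31;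
  `(13,3)` = 7−3√2 {1,5}, N 31;
  `(3,-2)` = 7+2√2 {1,6}, N 41;
  `(3,-9)` = 21+9√2 {2,4}, N 279;
  `(39,9)` = 21−9√2 {2,5}, N 279;
  `(9,-6)` = 21+6√2 {2,6}, N 369;
  `(5,-15)` = 35+15√2 {3,4}, N 775;
  `(65,15)` = 35−15√2 {3,5}, N 775;
  `(15,-10)` = 35+10√2 {3,6}, N 1025;
  `(77,17)` = 43−17√2 {4,6}, N 1271;
  `(51,7)` = 37−7√2 {5,6}, N 1271):
the class `[u + vσ]` differs from `[c]` for EVERY `c ∈ ℚ^×` — the component `W8.E.[u + vσ]` is none of the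
integer-indexed rows `[n]` and not the split row. [cite: Deligne1982HodgeCycles, §4 p. 30 (1) and Cor. 4.2] -/
theorem sqrtNegTwoPlusSqrtTwo_irrational_rows :
    haveI := fact_irreducible_realPolyQ_of_not_sq (R := X ^ 2 + C 4 * X + C 2) rfl disc_not_sq_four_two
    ∀ uv ∈ [((1 : ℤ), (-3 : ℤ)), (13, 3), (3, -2), (3, -9), (39, 9), (9, -6), (5, -15), (65, 15), (15, -10), (77, 17), (51, 7)],
      ∀ δ : (realField (X ^ 2 + C 4 * X + C 2))ˣ,
        (δ : realField (X ^ 2 + C 4 * X + C 2)) = AdjoinRoot.of (realPolyQ (X ^ 2 + C 4 * X + C 2)) (uv.1 : ℚ)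
            + AdjoinRoot.of (realPolyQ (X ^ 2 + C 4 * X + C 2)) (uv.2 : ℚ) * AdjoinRoot.root (realPolyQ (X ^ 2 + C 4 * X + C 2)) →
        ∀ (c : ℚ) (γ : (realField (X ^ 2 + C 4 * X + C 2))ˣ), (γ : realField (X ^ 2 + C 4 * X + C 2)) = (c : realField (X ^ 2 + C 4 * X + C 2)) →
          (QuotientGroup.mk δ : cmNormResidueGroup (X ^ 2 + C 4 * X + C 2)) ≠ QuotientGroup.mk γ := by
  haveI := fact_irreducible_realPolyQ_of_not_sq (R := X ^ 2 + C 4 * X + C 2) rfl disc_not_sq_four_two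
  intro uv huv δ hδ c γ hγ
  obtain ⟨u, v⟩ := uv
  simp only [List.mem_cons, Prod.mk.injEq, List.not_mem_nil, or_false] at huv
  rcases huv with ⟨rfl, rfl⟩ | ⟨rfl, rfl⟩ | ⟨rfl, rfl⟩ | ⟨rfl, rfl⟩ | ⟨rfl, rfl⟩ | ⟨rfl, rfl⟩ | ⟨rfl, rfl⟩ | ⟨rfl, rfl⟩ | ⟨rfl, rfl⟩ | ⟨rfl, rfl⟩ | ⟨rfl, rfl⟩
  · exact sqrtNegTwoPlusSqrtTwo_mk_ne_mk_ratCast_of_norm_thirtyOne rfl 1 (-3) (1) (by norm_num) (by norm_num) δ hδ c γ hγ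
  · exact sqrtNegTwoPlusSqrtTwo_mk_ne_mk_ratCast_of_norm_thirtyOne rfl 13 (3) (1) (by norm_num) (by norm_num) δ hδ c γ hγ
  · exact sqrtNegTwoPlusSqrtTwo_mk_ne_mk_ratCast_of_norm_fortyOne rfl 3 (-2) (1) (by norm_num) (by norm_num) δ hδ c γ hγ
  · exact sqrtNegTwoPlusSqrtTwo_mk_ne_mk_ratCast_of_norm_thirtyOne rfl 3 (-9) (9) (by norm_num) (by norm_num) δ hδ c γ hγ
  · exact sqrtNegTwoPlusSqrtTwo_mk_ne_mk_ratCast_of_norm_thirtyOne rfl 39 (9) (9) (by norm_num) (by norm_num) δ hδ c γ hγ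
  · exact sqrtNegTwoPlusSqrtTwo_mk_ne_mk_ratCast_of_norm_fortyOne rfl 9 (-6) (9) (by norm_num) (by norm_num) δ hδ c γ hγ
  · exact sqrtNegTwoPlusSqrtTwo_mk_ne_mk_ratCast_of_norm_thirtyOne rfl 5 (-15) (25) (by norm_num) (by norm_num) δ hδ c γ hγ
  · exact sqrtNegTwoPlusSqrtTwo_mk_ne_mk_ratCast_of_norm_thirtyOne rfl 65 (15) (25) (by norm_num) (by norm_num) δ hδ c γ hγ
  · exact sqrtNegTwoPlusSqrtTwo_mk_ne_mk_ratCast_of_norm_fortyOne rfl 15 (-10) (25) (by norm_num) (by norm_num) δ hδ c γ hγ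
  · exact sqrtNegTwoPlusSqrtTwo_mk_ne_mk_ratCast_of_norm_thirtyOne rfl 77 (17) (41) (by norm_num) (by norm_num) δ hδ c γ hγ
  · exact sqrtNegTwoPlusSqrtTwo_mk_ne_mk_ratCast_of_norm_thirtyOne rfl 51 (7) (41) (by norm_num) (by norm_num) δ hδ c γ hγ

end Summit.HodgeConjecture.HodgeConjecture.Ring2.WeilCoverageCM

end
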